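/-
Copyright (c) 2026. All rights reserved.
Released under Apache 2.0 license as described in the file LICENSE.
-/
import Literature.NumberTheory.Automorphic.DefiniteEichlerOrdersClassNumberFormula
import Literature.NumberTheory.Automorphic.DefiniteMaximalOrdersUnitIndexClasses
import Literature.NumberTheory.Automorphic.QuadraticOrdersRhoResidues
import HarnessLib

/-!
# The numbers `h₁, h₂, h₃` of ideal classes with `2, 4, 6` units for the definite Eichler orders of level `(M, p)`,
# `p ∤ 6M` prime, `M` squarefree: `h₂ = ½(2 − ρ_p(0,1))∏_{q∣M}ρ_q(0,1) = ½ε₂`, `h₃ = ½(2 − ρ_p(1,1))∏_{q∣M}ρ_q(1,1) = ½ε₃`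

[tag: quaternion_algebra] [tag: class_number] [tag: trace_formula] [tag: unit_group]

Topic `NumberTheory/Automorphic`; THEOREMS ONLY (no definition, no named fact, no instance; net Literature debt `0`).
Lane `lit-hodgefound`, seat p12, gen 48 — the `TODO(general form)` of `DefiniteMaximalOrdersUnitIndexClasses` («Composite `D`
and Eichler level `M > 1` (Voight Thm. 30.1.5's `ε₂, ε₃` products) are not treated») at Eichler level `M > 1`: for a Brandt setup
`S : XiSetup M p` (a definite Eichler order `O` of level `M` in the quaternion algebra of prime discriminant `p` over `ℚ`), `M`
squarefree, `p ∤ M`, `p ≠ 2, 3`, every left order `O_L(I_c)` has cyclic unit group of order `2 w_c ∈ {2, 4, 6}`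
(`Brandt.XiSetup.isCyclic_stabilizer_leftOrder`), `# Cls O = h₁ + h₂ + h₃` with `hᵢ = #{c : w_c = i}`
(`Brandt.XiSetup.natCard_weight_partition`), and the `t = 0`, `t = 1` elliptic terms of the `n = 1` Brandt trace identity at
level `(M, p)` (`Brandt.XiSetup.ellipticTerm_one_of_squarefree`:
`Σ_c #{x ∈ O_L(I_c) : trd x = t, nrd x = 1}/(2w_c) = ½ h_w(t² − 4) ∏_{q∣M} ρ_q(t,1) (2 − ρ_p(t,1))`, with
`#{x ∈ O_L(I_c) : trd x = 0, nrd x = 1} = 2·[w_c = 2]`, `#{… trd x = 1 …} = 2·[w_c = 3]`, `h_w(−4) = ½`, `h_w(−3) = ⅓`) give, exactly as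
Vignéras derives her Prop. V.3.2 at `M = 1` («En appliquant 2.4 et les formules des masses `M(B)`, quand `B = ℤ[√−1]` et `ℤ[√−3]`»):

* **`Brandt.XiSetup.natCard_weight_eq_two_of_squarefree`**: `h₂ = ½ (2 − ρ_p(0,1)) ∏_{q∣M} ρ_q(0,1)`;
  **`Brandt.XiSetup.natCard_weight_eq_three_of_squarefree`**: `h₃ = ½ (2 − ρ_p(1,1)) ∏_{q∣M} ρ_q(1,1)`
  (`ρ_q(t, n) = #{x mod q : x² − tx + n ≡ 0}`, `Brandt.rho`), and the forms in `ℕ` (`2h₂ = …`, `2h₃ = …`);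
* for `M` odd, in Legendre symbols — **`h₂ = ½ (1 − (−4∕p)) ∏_{q∣M} (1 + (−4∕q)) = ½ ε₂`, `h₃ = ½ (1 − (−3∕p)) ∏_{q∣M} (1 + (−3∕q)) = ½ ε₃`**
  with Voight's `ε₂ = ∏_{p∣D}(1 − (−4∕p)) ∏_{q∣M}(1 + (−4∕q))`, `ε₃ = ∏_{p∣D}(1 − (−3∕p)) ∏_{q∣M}(1 + (−3∕q))` of Thm. 30.1.5
  (`…_legendreSym_of_squarefree`), so that THM. 30.1.5 READS `# Cls O = mass + h₂/2 + 2h₃/3`, i.e. `mass = h₁ + h₂/2 + h₃/3 = Σ_c 1/w_c`;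
* **`Brandt.XiSetup.natCard_weight_eq_one_of_squarefree`**: `h₁ = (p − 1)ψ(M)/12 − ¼(2 − ρ_p(0,1))∏ρ_q(0,1) − ⅙(2 − ρ_p(1,1))∏ρ_q(1,1)`
  (with `DefiniteEichlerOrdersClassNumberFormula`);
* vanishing: `h₃ = 0` whenever `2 ∣ M` (`ρ₂(1,1) = 0`: `x² − x + 1` has no root mod `2` — a level divisible by `2` kills the units of
  order `3`), `h₂ = 0` whenever some prime `q ≡ 3 (mod 4)` divides `M` or `p ≡ 1 (mod 4)`, `h₃ = 0` whenever some prime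
  `q ≡ 2 (mod 3)` divides `M` or `p ≡ 1 (mod 3)`;
* the worked level `(M, p) = (2, 7)` (`# Cls O = 2`, `DefiniteEichlerOrdersClassNumberFormula`): `h₂ = 1`, `h₃ = 0`, `h₁ = 1` — the two
  ideal classes of the level-`2` Eichler orders of the definite quaternion algebra of discriminant `7` have unit groups of orders `4` and `2`.

## Sources

* M.-F. Vignéras, *Arithmétique des algèbres de quaternions*, LNM 800 (1980), Ch. V §3 Prop. 3.2 (`h₂ = ½∏_{p∣D}(1 − (−4∕p))`,
  `h₃ = ½∏_{p∣D}(1 − (−3∕p))` for maximal orders; the proof «en appliquant 2.4» = the trace formula Ch. V §2 Prop. 2.4 with the local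
  embedding numbers of Ch. II §3, which at an Eichler level `q ∥ M` are `1 + ((t² − 4n)∕q)` — Ch. III §5 Exercice 5.2), Ch. V §2 Cor. 2.5.
  [cite: VignerasLNM800, Ch. V §3 Prop. 3.2; Ch. V §2 Prop. 2.4, Cor. 2.5; Ch. III §5 Exercice 5.2]
* J. Voight, *Quaternion Algebras*, GTM 288 (2021), Thm. 30.1.5 (`# Cls O = φ(D)ψ(M)/12 + ε₂/4 + ε₃/3`, the definition of `ε₂, ε₃`),
  30.1.6–30.1.7, Thm. 11.5.14, Exercise 30.6. [cite: Voight2021, Thm. 30.1.5; Thm. 11.5.14]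
* M. Eichler, *Zur Zahlentheorie der Quaternionen-Algebren*, J. reine angew. Math. 195 (1955), §8 (Klassenzahlformel with the
  embedding numbers at the level). [cite: Eichler1955, §8]
* K. Ireland, M. Rosen, *A Classical Introduction to Modern Number Theory* (1982), Ch. 5 §1–§2. [cite: IrelandRosen1982, Ch. 5 §2]

## Scope (honest)

Theorems only. Level `(M, p)` with `M` squarefree, `p` prime, `p ∤ M`, `p ∉ {2, 3}` (for `p ∈ {2, 3}` with `M > 1` the unit groups are
still cyclic but the tree's `natCard_traceNormSet_zero_one ∕ _one_one` are stated for `N⁻ ∉ {2, 3}`); composite discriminant and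
non-squarefree level are not treated (the tree's embedding counts `sum_card_traceNormSet_div_eq_sum_hw_br` need `N⁻` prime, `N⁺` squarefree).
The identification `hᵢ = ½εᵢ` at level `M > 1` is derived here (Vignéras prints it at `M = 1`); Voight prints `ε₂, ε₃` only inside Thm. 30.1.5.
-/

noncomputable section

open Finset
open Literature.NumberTheory.Automorphic.Brandt
open Literature.NumberTheory.Automorphic.HeckeTraceFormulaGL2Level

namespace Literature.NumberTheory.Automorphic

variable {M p : ℕ}

/-! ## §1 `h₂` and `h₃` at level `(M, p)` -/

/-- **`h₂ = ½ (2 − ρ_p(0,1)) ∏_{q∣M} ρ_q(0,1)`**: the number of ideal classes of a definite Eichler order of level `(M, p)`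
(`M` squarefree, `p ∤ 6M` prime) whose left order has `4` units — the `t = 0` term of the `n = 1` trace identity. [cite: VignerasLNM800, Ch. V §3 Prop. 3.2 (M = 1); Ch. V §2 Prop. 2.4] [cite: Voight2021, Thm. 30.1.5 (ε₂)] -/
theorem Brandt.XiSetup.natCard_weight_eq_two_of_squarefree (hsq : Squarefree M) (hp : p.Prime) (hp2 : p ≠ 2)
    (hp3 : p ≠ 3) (hpM : ¬ p ∣ M) (S : XiSetup M p) :
    (Nat.card {c : ClassSet S.O // weight S.O c = 2} : ℚ) =
      (2 - (rho p 0 1 : ℚ)) * (∏ q ∈ M.primeFactors, (rho q 0 1 : ℚ)) / 2 := by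
  classical
  letI : Fintype (ClassSet S.O) := Fintype.ofFinite _
  have key := S.ellipticTerm_one_of_squarefree hsq.ne_zero hsq hp hpM (t := 0) (by norm_num)
    ellipticConductors_zero_one
  simp only [Int.cast_zero, Nat.cast_one] at key
  have hterm : ∀ i : ClassSet S.O, (Nat.card (traceNormSet i.rep (0 : ℚ) 1) : ℚ) / (2 * weight S.O i) =
      if weight S.O i = 2 then (1 / 2 : ℚ) else 0 := by
    intro i
    rw [S.natCard_traceNormSet_zero_one hp2 hp3 i]
    split_ifs with h
    · rw [h]; norm_num
    · rw [Nat.cast_zero, zero_div]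
  rw [Finset.sum_congr rfl fun i _ => hterm i, Finset.sum_ite, Finset.sum_const_zero, add_zero, Finset.sum_const,
    nsmul_eq_mul] at key
  simp only [hw] at key
  norm_num at key
  rw [Nat.card_eq_fintype_card, Fintype.card_subtype]
  linarith

/-- **`h₃ = ½ (2 − ρ_p(1,1)) ∏_{q∣M} ρ_q(1,1)`**: the number of ideal classes whose left order has `6` units — the `t = 1` term of the
`n = 1` trace identity at level `(M, p)`. [cite: VignerasLNM800, Ch. V §3 Prop. 3.2 (M = 1); Ch. V §2 Prop. 2.4] [cite: Voight2021, Thm. 30.1.5 (ε₃)] -/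
theorem Brandt.XiSetup.natCard_weight_eq_three_of_squarefree (hsq : Squarefree M) (hp : p.Prime) (hp2 : p ≠ 2)
    (hp3 : p ≠ 3) (hpM : ¬ p ∣ M) (S : XiSetup M p) :
    (Nat.card {c : ClassSet S.O // weight S.O c = 3} : ℚ) =
      (2 - (rho p 1 1 : ℚ)) * (∏ q ∈ M.primeFactors, (rho q 1 1 : ℚ)) / 2 := by
  classical
  letI : Fintype (ClassSet S.O) := Fintype.ofFinite _
  have key := S.ellipticTerm_one_of_squarefree hsq.ne_zero hsq hp hpM (t := 1) (by norm_num)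
    ellipticConductors_one_one
  simp only [Int.cast_one, Nat.cast_one] at key
  have hterm : ∀ i : ClassSet S.O, (Nat.card (traceNormSet i.rep (1 : ℚ) 1) : ℚ) / (2 * weight S.O i) =
      if weight S.O i = 3 then (1 / 3 : ℚ) else 0 := by
    intro i
    rw [S.natCard_traceNormSet_one_one hp2 hp3 i]
    split_ifs with h
    · rw [h]; norm_num
    · rw [Nat.cast_zero, zero_div]
  rw [Finset.sum_congr rfl fun i _ => hterm i, Finset.sum_ite, Finset.sum_const_zero, add_zero, Finset.sum_const,
    nsmul_eq_mul] at key
  simp only [hw] at key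
  norm_num at key
  rw [Nat.card_eq_fintype_card, Fintype.card_subtype]
  linarith

/-- `ρ_q(0, 1) ≤ 2` and `ρ_q(1, 1) ≤ 2` for `q` prime (a quadratic congruence has at most two roots mod a prime). [folklore] [cite: IrelandRosen1982, Ch. 5 §1] -/
private theorem rho_le_two' {q : ℕ} (hq : q.Prime) (t : ℤ) (ht : t = 0 ∨ t = 1) : rho q t 1 ≤ 2 := by
  by_cases hq2 : q = 2
  · subst hq2; rcases ht with rfl | rfl <;> decide
  · haveI := Fact.mk hq
    have e := rho_eq_one_add_legendreSym (q := q) hq2 t 1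
    by_cases hz : ((t ^ 2 - 4 * 1 : ℤ) : ZMod q) = 0
    · rw [(legendreSym.eq_zero_iff q _).mpr hz] at e; omega
    · rcases legendreSym.eq_one_or_neg_one q hz with hl | hl <;> rw [hl] at e <;> omega

/-- The form in `ℕ`: **`2 h₂ = (2 − ρ_p(0,1)) ∏_{q∣M} ρ_q(0,1)`**. [cite: VignerasLNM800, Ch. V §3 Prop. 3.2] [cite: Voight2021, Thm. 30.1.5] -/
theorem Brandt.XiSetup.two_mul_natCard_weight_eq_two_of_squarefree (hsq : Squarefree M) (hp : p.Prime) (hp2 : p ≠ 2)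
    (hp3 : p ≠ 3) (hpM : ¬ p ∣ M) (S : XiSetup M p) :
    2 * Nat.card {c : ClassSet S.O // weight S.O c = 2} = (2 - rho p 0 1) * ∏ q ∈ M.primeFactors, rho q 0 1 := by
  have h := S.natCard_weight_eq_two_of_squarefree hsq hp hp2 hp3 hpM
  have h2 : rho p 0 1 ≤ 2 := rho_le_two' hp 0 (Or.inl rfl)
  have key : (2 * Nat.card {c : ClassSet S.O // weight S.O c = 2} : ℚ) =
      ((2 - rho p 0 1 : ℕ) : ℚ) * ∏ q ∈ M.primeFactors, (rho q 0 1 : ℚ) := by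
    rw [h, Nat.cast_sub h2]
    push_cast
    ring
  exact_mod_cast key

/-- The form in `ℕ`: **`2 h₃ = (2 − ρ_p(1,1)) ∏_{q∣M} ρ_q(1,1)`**. [cite: VignerasLNM800, Ch. V §3 Prop. 3.2] [cite: Voight2021, Thm. 30.1.5] -/
theorem Brandt.XiSetup.two_mul_natCard_weight_eq_three_of_squarefree (hsq : Squarefree M) (hp : p.Prime) (hp2 : p ≠ 2)
    (hp3 : p ≠ 3) (hpM : ¬ p ∣ M) (S : XiSetup M p) :
    2 * Nat.card {c : ClassSet S.O // weight S.O c = 3} = (2 - rho p 1 1) * ∏ q ∈ M.primeFactors, rho q 1 1 := by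
  have h := S.natCard_weight_eq_three_of_squarefree hsq hp hp2 hp3 hpM
  have h2 : rho p 1 1 ≤ 2 := rho_le_two' hp 1 (Or.inr rfl)
  have key : (2 * Nat.card {c : ClassSet S.O // weight S.O c = 3} : ℚ) =
      ((2 - rho p 1 1 : ℕ) : ℚ) * ∏ q ∈ M.primeFactors, (rho q 1 1 : ℚ) := by
    rw [h, Nat.cast_sub h2]
    push_cast
    ring
  exact_mod_cast key

/-! ## §2 Legendre form: `h₂ = ½ε₂`, `h₃ = ½ε₃` (`M` odd) -/

/-- **`h₂ = ½ (1 − (−4∕p)) ∏_{q∣M} (1 + (−4∕q)) = ½ε₂`** for `M` odd squarefree, `p ∤ 6M` prime — Voight's `ε₂` of Thm. 30.1.5 at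
`D = p`, `N = pM`. [cite: Voight2021, Thm. 30.1.5 (ε₂)] [cite: VignerasLNM800, Ch. V §3 Prop. 3.2] -/
theorem Brandt.XiSetup.natCard_weight_eq_two_legendreSym_of_squarefree (hsq : Squarefree M) [hpF : Fact p.Prime]
    (hp2 : p ≠ 2) (hp3 : p ≠ 3) (hM2 : ¬ 2 ∣ M) (hpM : ¬ p ∣ M) (S : XiSetup M p) :
    (Nat.card {c : ClassSet S.O // weight S.O c = 2} : ℚ) =
      (1 - (legendreSym p (-4) : ℚ)) *
        (∏ q ∈ M.primeFactors.attach, (1 + (@legendreSym q ⟨Nat.prime_of_mem_primeFactors q.2⟩ (-4) : ℚ))) / 2 := by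
  have h0 := rho_eq_one_add_legendreSym (q := p) hp2 0 1
  norm_num at h0
  have h0' : (rho p 0 1 : ℚ) = 1 + (legendreSym p (-4) : ℚ) := by exact_mod_cast h0
  have hP0 : ∏ q ∈ M.primeFactors, (rho q 0 1 : ℚ) =
      ∏ q ∈ M.primeFactors.attach, (1 + (@legendreSym q ⟨Nat.prime_of_mem_primeFactors q.2⟩ (-4) : ℚ)) := by
    rw [← Finset.prod_attach]
    refine Finset.prod_congr rfl fun q _ => ?_
    haveI : Fact (q : ℕ).Prime := ⟨Nat.prime_of_mem_primeFactors q.2⟩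
    have hq2 : (q : ℕ) ≠ 2 := fun h => hM2 (h ▸ Nat.dvd_of_mem_primeFactors q.2)
    have h := rho_eq_one_add_legendreSym (q := (q : ℕ)) hq2 0 1
    norm_num at h
    exact_mod_cast h
  rw [S.natCard_weight_eq_two_of_squarefree hsq hpF.out hp2 hp3 hpM, h0', hP0]
  ring

/-- **`h₃ = ½ (1 − (−3∕p)) ∏_{q∣M} (1 + (−3∕q)) = ½ε₃`** for `M` odd squarefree, `p ∤ 6M` prime. [cite: Voight2021, Thm. 30.1.5 (ε₃)] [cite: VignerasLNM800, Ch. V §3 Prop. 3.2] -/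
theorem Brandt.XiSetup.natCard_weight_eq_three_legendreSym_of_squarefree (hsq : Squarefree M) [hpF : Fact p.Prime]
    (hp2 : p ≠ 2) (hp3 : p ≠ 3) (hM2 : ¬ 2 ∣ M) (hpM : ¬ p ∣ M) (S : XiSetup M p) :
    (Nat.card {c : ClassSet S.O // weight S.O c = 3} : ℚ) =
      (1 - (legendreSym p (-3) : ℚ)) *
        (∏ q ∈ M.primeFactors.attach, (1 + (@legendreSym q ⟨Nat.prime_of_mem_primeFactors q.2⟩ (-3) : ℚ))) / 2 := by
  have h1 := rho_eq_one_add_legendreSym (q := p) hp2 1 1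
  norm_num at h1
  have h1' : (rho p 1 1 : ℚ) = 1 + (legendreSym p (-3) : ℚ) := by exact_mod_cast h1
  have hP1 : ∏ q ∈ M.primeFactors, (rho q 1 1 : ℚ) =
      ∏ q ∈ M.primeFactors.attach, (1 + (@legendreSym q ⟨Nat.prime_of_mem_primeFactors q.2⟩ (-3) : ℚ)) := by
    rw [← Finset.prod_attach]
    refine Finset.prod_congr rfl fun q _ => ?_
    haveI : Fact (q : ℕ).Prime := ⟨Nat.prime_of_mem_primeFactors q.2⟩
    have hq2 : (q : ℕ) ≠ 2 := fun h => hM2 (h ▸ Nat.dvd_of_mem_primeFactors q.2)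
    have h := rho_eq_one_add_legendreSym (q := (q : ℕ)) hq2 1 1
    norm_num at h
    exact_mod_cast h
  rw [S.natCard_weight_eq_three_of_squarefree hsq hpF.out hp2 hp3 hpM, h1', hP1]
  ring

/-! ## §3 `h₁`, and Thm. 30.1.5 as `# Cls O = (h₁ + h₂/2 + h₃/3) + h₂/2 + 2h₃/3` -/

/-- **`h₁ = (p − 1)ψ(M)/12 − ¼(2 − ρ_p(0,1))∏_{q∣M}ρ_q(0,1) − ⅙(2 − ρ_p(1,1))∏_{q∣M}ρ_q(1,1)`**: the number of ideal classes with unit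
group `{±1}` at level `(M, p)` (`h₁ = # Cls O − h₂ − h₃` and the class number formula). [cite: Voight2021, Thm. 30.1.5] [cite: VignerasLNM800, Ch. V §3 Prop. 3.2] -/
theorem Brandt.XiSetup.natCard_weight_eq_one_of_squarefree (hsq : Squarefree M) (hp : p.Prime) (hp2 : p ≠ 2)
    (hp3 : p ≠ 3) (hpM : ¬ p ∣ M) (S : XiSetup M p) :
    (Nat.card {c : ClassSet S.O // weight S.O c = 1} : ℚ) =
      ((p : ℚ) - 1) / 12 * (∏ q ∈ M.primeFactors, ((q : ℚ) + 1)) -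
        (2 - (rho p 0 1 : ℚ)) * (∏ q ∈ M.primeFactors, (rho q 0 1 : ℚ)) / 4 -
        (2 - (rho p 1 1 : ℚ)) * (∏ q ∈ M.primeFactors, (rho q 1 1 : ℚ)) / 6 := by
  have hpart := S.natCard_weight_partition hp2 hp3
  have hcls := S.natCard_classSet_eq_rho_of_squarefree hsq hp hpM
  have h2 := S.natCard_weight_eq_two_of_squarefree hsq hp hp2 hp3 hpM
  have h3 := S.natCard_weight_eq_three_of_squarefree hsq hp hp2 hp3 hpM
  have hpart' : (Nat.card {c : ClassSet S.O // weight S.O c = 1} : ℚ) + Nat.card {c : ClassSet S.O // weight S.O c = 2} +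
      Nat.card {c : ClassSet S.O // weight S.O c = 3} = Nat.card (ClassSet S.O) := by exact_mod_cast hpart
  linarith

/-- **The mass is `h₁ + h₂/2 + h₃/3`**: `Σ_c 1/w_c = h₁ + h₂/2 + h₃/3` at level `(M, p)`, `p ∤ 6M` (every `w_c ∈ {1, 2, 3}`). [cite: VignerasLNM800, Ch. V §2 Cor. 2.5 and §3 Prop. 3.2] [cite: Voight2021, Thm. 25.3.18 and 26.1.6] -/
theorem Brandt.XiSetup.sum_inv_weight_eq_natCard_weight (S : XiSetup M p) (hp2 : p ≠ 2) (hp3 : p ≠ 3)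
    [Fintype (ClassSet S.O)] :
    ∑ c, (1 : ℚ) / weight S.O c =
      Nat.card {c : ClassSet S.O // weight S.O c = 1} + (Nat.card {c : ClassSet S.O // weight S.O c = 2} : ℚ) / 2 +
        (Nat.card {c : ClassSet S.O // weight S.O c = 3} : ℚ) / 3 := by
  classical
  have hw : ∀ c : ClassSet S.O, weight S.O c = 1 ∨ weight S.O c = 2 ∨ weight S.O c = 3 := fun c => by
    have h3 := S.weight_le_three hp2 hp3 c
    have h0 := S.one_le_weight c
    omega
  have hterm : ∀ c : ClassSet S.O, (1 : ℚ) / weight S.O c =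
      (if weight S.O c = 1 then (1 : ℚ) else 0) + (if weight S.O c = 2 then (1 / 2 : ℚ) else 0) +
        (if weight S.O c = 3 then (1 / 3 : ℚ) else 0) := by
    intro c
    rcases hw c with h | h | h <;> simp [h]
  rw [Finset.sum_congr rfl fun c _ => hterm c, Finset.sum_add_distrib, Finset.sum_add_distrib, Finset.sum_ite,
    Finset.sum_ite, Finset.sum_ite, Finset.sum_const_zero, Finset.sum_const_zero, Finset.sum_const_zero, add_zero, add_zero,
    add_zero, Finset.sum_const, Finset.sum_const, Finset.sum_const, nsmul_eq_mul, nsmul_eq_mul, nsmul_eq_mul, mul_one,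
    Nat.card_eq_fintype_card, Nat.card_eq_fintype_card, Nat.card_eq_fintype_card, Fintype.card_subtype, Fintype.card_subtype,
    Fintype.card_subtype]
  ring

/-! ## §4 Vanishing of `h₂`, `h₃` -/

/-- **An even level kills the units of order `3`: `2 ∣ M ⟹ h₃ = 0`** (`ρ₂(1, 1) = 0`: `x² − x + 1` has no root mod `2`, i.e. `ℤ[ζ₃]`
does not embed into an Eichler order of even level). [cite: Voight2021, Thm. 30.1.5 (ε₃ with (−3∕2) = −1)] [cite: VignerasLNM800, Ch. III §5 Exercice 5.2] -/
theorem Brandt.XiSetup.natCard_weight_eq_three_eq_zero_of_two_dvd (hsq : Squarefree M) (hp : p.Prime) (hp2 : p ≠ 2)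
    (hp3 : p ≠ 3) (hpM : ¬ p ∣ M) (h2M : 2 ∣ M) (S : XiSetup M p) :
    Nat.card {c : ClassSet S.O // weight S.O c = 3} = 0 := by
  have h := S.two_mul_natCard_weight_eq_three_of_squarefree hsq hp hp2 hp3 hpM
  have hmem : 2 ∈ M.primeFactors := Nat.mem_primeFactors.mpr ⟨Nat.prime_two, h2M, hsq.ne_zero⟩
  rw [Finset.prod_eq_zero hmem (show rho 2 1 1 = 0 by decide), mul_zero] at h
  omega

/-- **A prime `q ≡ 2 (mod 3)` in the level kills the units of order `3`: `q ∣ M, q ≡ 2 (mod 3) ⟹ h₃ = 0`** (`ρ_q(1,1) = 0`).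
[cite: Voight2021, Thm. 30.1.5 (ε₃)] [cite: IrelandRosen1982, Ch. 5 §2] -/
theorem Brandt.XiSetup.natCard_weight_eq_three_eq_zero_of_dvd (hsq : Squarefree M) (hp : p.Prime) (hp2 : p ≠ 2)
    (hp3 : p ≠ 3) (hpM : ¬ p ∣ M) {q : ℕ} (hq : q.Prime) (hqM : q ∣ M) (hq3 : q % 3 = 2) (S : XiSetup M p) :
    Nat.card {c : ClassSet S.O // weight S.O c = 3} = 0 := by
  haveI := Fact.mk hq
  have h := S.two_mul_natCard_weight_eq_three_of_squarefree hsq hp hp2 hp3 hpM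
  have hmem : q ∈ M.primeFactors := Nat.mem_primeFactors.mpr ⟨hq, hqM, hsq.ne_zero⟩
  rw [Finset.prod_eq_zero hmem (rho_one_one_eq_zero_iff.mpr hq3), mul_zero] at h
  omega

/-- **A prime `q ≡ 3 (mod 4)` in the level kills the units of order `4`: `q ∣ M, q ≡ 3 (mod 4) ⟹ h₂ = 0`** (`ρ_q(0,1) = 0`).
[cite: Voight2021, Thm. 30.1.5 (ε₂)] [cite: IrelandRosen1982, Ch. 5 §1] -/
theorem Brandt.XiSetup.natCard_weight_eq_two_eq_zero_of_dvd (hsq : Squarefree M) (hp : p.Prime) (hp2 : p ≠ 2)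
    (hp3 : p ≠ 3) (hpM : ¬ p ∣ M) {q : ℕ} (hq : q.Prime) (hqM : q ∣ M) (hq4 : q % 4 = 3) (S : XiSetup M p) :
    Nat.card {c : ClassSet S.O // weight S.O c = 2} = 0 := by
  haveI := Fact.mk hq
  have h := S.two_mul_natCard_weight_eq_two_of_squarefree hsq hp hp2 hp3 hpM
  have hmem : q ∈ M.primeFactors := Nat.mem_primeFactors.mpr ⟨hq, hqM, hsq.ne_zero⟩
  rw [Finset.prod_eq_zero hmem (rho_zero_one_eq_zero_iff.mpr hq4), mul_zero] at h
  omega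

/-- **`p ≡ 1 (mod 4) ⟹ h₂ = 0`** at every level `(M, p)` (`ρ_p(0,1) = 2`: `ℚ(√−1)` splits at `p`, so it does not embed in the algebra).
[cite: VignerasLNM800, Ch. V §3 Prop. 3.2] [cite: IrelandRosen1982, Ch. 5 §1] -/
theorem Brandt.XiSetup.natCard_weight_eq_two_eq_zero_of_mod_four (hsq : Squarefree M) (hp : p.Prime) (hp2 : p ≠ 2)
    (hp3 : p ≠ 3) (hpM : ¬ p ∣ M) (hp4 : p % 4 = 1) (S : XiSetup M p) :
    Nat.card {c : ClassSet S.O // weight S.O c = 2} = 0 := by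
  haveI := Fact.mk hp
  have h := S.two_mul_natCard_weight_eq_two_of_squarefree hsq hp hp2 hp3 hpM
  rw [(rho_zero_one_eq_two_iff hp2).mpr hp4, Nat.sub_self, zero_mul] at h
  omega

/-- **`p ≡ 1 (mod 3) ⟹ h₃ = 0`** at every level `(M, p)` (`ρ_p(1,1) = 2`). [cite: VignerasLNM800, Ch. V §3 Prop. 3.2] [cite: IrelandRosen1982, Ch. 5 §2] -/
theorem Brandt.XiSetup.natCard_weight_eq_three_eq_zero_of_mod_three (hsq : Squarefree M) (hp : p.Prime) (hp2 : p ≠ 2)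
    (hp3 : p ≠ 3) (hpM : ¬ p ∣ M) (hp31 : p % 3 = 1) (S : XiSetup M p) :
    Nat.card {c : ClassSet S.O // weight S.O c = 3} = 0 := by
  haveI := Fact.mk hp
  have h := S.two_mul_natCard_weight_eq_three_of_squarefree hsq hp hp2 hp3 hpM
  rw [(rho_one_one_eq_two_iff hp3).mpr hp31, Nat.sub_self, zero_mul] at h
  omega

/-! ## §5 The level `(M, p) = (2, 7)`: `h = 2 = h₁ + h₂`, `h₂ = 1`, `h₃ = 0` -/

/-- **At level `(2, 7)`: exactly one of the two ideal classes has a left order with `4` units** (`h₂ = (2 − ρ₇(0,1))ρ₂(0,1)/2 = 1`).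
[cite: Voight2021, Thm. 30.1.5] -/
theorem Brandt.XiSetup.natCard_weight_eq_two_level_two_seven (S : XiSetup 2 7) :
    Nat.card {c : ClassSet S.O // weight S.O c = 2} = 1 := by
  have h := S.two_mul_natCard_weight_eq_two_of_squarefree Nat.prime_two.squarefree (by norm_num : Nat.Prime 7) (by norm_num)
    (by norm_num) (by norm_num)
  rw [Nat.prime_two.primeFactors, Finset.prod_singleton, show rho 7 0 1 = 0 by decide, show rho 2 0 1 = 1 by decide] at h
  omega

/-- **At level `(2, 7)`: no ideal class has a left order with `6` units** (`2 ∣ M`). [cite: Voight2021, Thm. 30.1.5] -/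
theorem Brandt.XiSetup.natCard_weight_eq_three_level_two_seven (S : XiSetup 2 7) :
    Nat.card {c : ClassSet S.O // weight S.O c = 3} = 0 :=
  S.natCard_weight_eq_three_eq_zero_of_two_dvd Nat.prime_two.squarefree (by norm_num : Nat.Prime 7) (by norm_num)
    (by norm_num) (by norm_num) (dvd_refl 2)

/-- **At level `(2, 7)`: the other ideal class has unit group `{±1}`** (`h₁ = h − h₂ − h₃ = 2 − 1 − 0 = 1`). [cite: Voight2021, Thm. 30.1.5] -/
theorem Brandt.XiSetup.natCard_weight_eq_one_level_two_seven (S : XiSetup 2 7) :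
    Nat.card {c : ClassSet S.O // weight S.O c = 1} = 1 := by
  have hpart := S.natCard_weight_partition (by norm_num) (by norm_num)
  rw [S.natCard_weight_eq_two_level_two_seven, S.natCard_weight_eq_three_level_two_seven,
    S.natCard_classSet_level_two_seven] at hpart
  omega

end Literature.NumberTheory.Automorphic

end
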